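import Summits.CriticalPhenomena.CardyFormulaZ2.Theorems.CardySusyWardParafermionFamiliesToSLESixTouchLowerBoundD

/-!
# Touch lower bound on diagonal free walls (stub `stub_touchLowerBound`, reshape r2, of the line
# `exact-potential-schwarz-christoffel`, crux stmt-CriticalPhenomena-10814), E: the LOCAL touch lower bound

The local half of `stub_touchLowerBound` (`TouchLowerBound`, reshape r2: diagonal-rectilinear polygons, window
form), registered sub-goal `touchLowerBound_local`. For a discretisation family `Λ` of a Dobrushin domain `P`
(the six `IsFamily` fields), a window `W` whose closure misses the wired arc `P.arc 0`, and a flat DIAGONAL piece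
of the free arc inside `W` presented as a one-sided box (`P` contains `{|a x - b y - t₀| < wτ, c - wν < a x + b y < c}`
and misses `{|a x - b y - t₀| < wτ, c < a x + b y < c + wν}`, `a, b = ±1`): there are `η, m > 0` such that,
eventually in the mesh `δ`,

  `m ≤ δ^{2/3} · Σ_x 1{x touch site of (Λ δ) with mesh point in W} · P(x is joined by open edges of the completed
  configuration (Λ δ).bcBondConfig ω to a site at distance ≥ η)`,

the touch sites being exactly those of the stub (off both discrete arcs, with an `Ω_δ`-neighbour on the free arc
`zdArcB`). Proof: the wall package of part D pins the lattice near the piece (`k = ⌈c/δ⌉ - 1` the last level under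
the line); the `≥ wτ/(8δ)` sites of level `k - 2` over the middle of the piece are touch sites (`touchSite_mem`:
off the arcs, their level-`(k-1)` neighbour on `zdArcB`, their mesh point in `W`); for each of them the
general-position wall arm of part A (`wallArm_bc_lower`: Ikhlef–Ponsaing's strip law `IkhlefPonsaingFirstPassage_holds`
+ the RSW/FKG localisation `S5.armStd_lower`, transported by the wall automorphisms) inside the band of `3n` levels,
`n = ⌊w₀/(16δ)⌋` (`w₀ = min wν wτ`), whose sites are pairwise `Ω_δ`-adjacent and off `zdArcB` (`band_subset`),
gives probability `≥ c₀ n^{-1/3} ≥ c₀ (16δ/w₀)^{1/3}`, the far end of the arm being at distance `≥ 3nδ/2 ≥ w₀/32`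
(`far_of_level`); summing (`sum_le_finsum_of_nonneg`, `card_lower`),
`Σ ≥ (wτ/(8δ)) c₀ (16/w₀)^{1/3} δ^{1/3} = m δ^{-2/3}`.

What is NOT here (the missing GLUING half of `stub_touchLowerBound`): joining the far end of the arm to the discrete
WIRED arc `zdArcA` through the bulk of `P` with probability bounded below uniformly in `δ` (RSW chains + Harris–FKG,
`BoxCrossingLowerBound`-style), and the extraction of the one-sided box from `IsDiagRectilinear P` and an open window
meeting `P.arc 1` (Baire on the finitely many sides + the Jordan curve theorem for one-sidedness).
-/

noncomputable section

namespace Summit.CriticalPhenomena.CardyFormulaZ2.Theorems.ParafermionFamiliesToSLESix.TouchLowerBound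

open Set Metric Complex Filter MeasureTheory
open scoped Topology ENNReal
open Literature.Probability.LatticeModels Literature.Probability.Percolation
open Literature.Probability.RandomPlanarGeometry
open Summit.CriticalPhenomena.CardyFormulaZ2.Theorems.ParafermionPrecompact.Negative (IsFamily)

local notation3 "μ" => bondPercolation (zdGraph 2) half

/-! ## Small tools -/

/-- The level separates points by at most twice their distance. [folklore] -/
theorem abs_level_sub_le {a b : ℤ} (ha : a = 1 ∨ a = -1) (hb : b = 1 ∨ b = -1) (p q : ℂ) :
    |((a : ℝ) * p.re + b * p.im) - ((a : ℝ) * q.re + b * q.im)| ≤ 2 * dist p q := by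
  rw [Complex.dist_eq]
  have hre := Complex.abs_re_le_norm (p - q)
  have him := Complex.abs_im_le_norm (p - q)
  simp only [sub_re, sub_im] at hre him
  rw [abs_le] at hre him ⊢
  rcases ha with rfl | rfl <;> rcases hb with rfl | rfl <;> push_cast <;> constructor <;> linarith

/-- **A finite partial sum of a nonnegative function with finite support is at most its `finsum`.** [folklore] -/
theorem sum_le_finsum_of_nonneg {α : Type*} [DecidableEq α] {f : α → ℝ} (hf : ∀ x, 0 ≤ f x)
    (hfin : (Function.support f).Finite) (F : Finset α) : ∑ x ∈ F, f x ≤ ∑ᶠ x, f x := by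
  rw [finsum_eq_sum_of_support_subset f (s := F ∪ hfin.toFinset)
    (by rw [Finset.coe_union, Set.Finite.coe_toFinset]; exact subset_union_right)]
  exact Finset.sum_le_sum_of_subset_of_nonneg Finset.subset_union_left fun x _ _ => hf x

/-- Numerics of the mesh: `δ^{2/3} · (wτ/(8δ)) · (K δ^{1/3}) = K wτ / 8`. [folklore] -/
theorem rpow_bookkeeping {δ wτ K : ℝ} (hδ : 0 < δ) :
    δ ^ ((2:ℝ) / 3) * (wτ / (8 * δ) * (K * δ ^ ((1:ℝ) / 3))) = K * wτ / 8 := by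
  have h : δ ^ ((2:ℝ) / 3) * δ ^ ((1:ℝ) / 3) = δ := by
    rw [← Real.rpow_add hδ]; norm_num
  calc δ ^ ((2:ℝ) / 3) * (wτ / (8 * δ) * (K * δ ^ ((1:ℝ) / 3)))
      = (δ ^ ((2:ℝ) / 3) * δ ^ ((1:ℝ) / 3)) * (K * wτ) / (8 * δ) := by ring
    _ = δ * (K * wτ) / (8 * δ) := by rw [h]
    _ = K * wτ / 8 := by field_simp

/-- Numerics of the band: `n ≤ w/(16δ)`, `n > 0` give `(16/w)^{1/3} δ^{1/3} ≤ n^{-1/3}`. [folklore] -/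
theorem rpow_band {δ w : ℝ} {n : ℕ} (hδ : 0 < δ) (hw : 0 < w) (hn : 0 < n) (hnle : (n : ℝ) * δ ≤ w / 16) :
    (16 / w) ^ ((1:ℝ) / 3) * δ ^ ((1:ℝ) / 3) ≤ (n : ℝ) ^ (-(1:ℝ) / 3) := by
  have hn' : (n : ℝ) ≤ w / (16 * δ) := by
    rw [le_div_iff₀ (by positivity)]; linarith
  have e1 : (16 / w) ^ ((1:ℝ) / 3) * δ ^ ((1:ℝ) / 3) = (16 * δ / w) ^ ((1:ℝ) / 3) := by
    rw [← Real.mul_rpow (by positivity) hδ.le]; congr 1; ring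
  have e2 : (16 * δ / w) ^ ((1:ℝ) / 3) = (w / (16 * δ)) ^ (-(1:ℝ) / 3) := by
    rw [show (-(1:ℝ) / 3) = -((1:ℝ) / 3) by ring, Real.rpow_neg (by positivity), ← Real.inv_rpow (by positivity),
      inv_div]
  rw [e1, e2]
  exact Real.rpow_le_rpow_of_nonpos (by exact_mod_cast hn) hn' (by norm_num)

/-- **Counting the touch sites**: the integers `p` with `|δ (2p - (k-2)) - t₀| ≤ wτ/4` number `≥ wτ/(8δ)`.
[folklore] -/
theorem card_lower {δ wτ t₀ : ℝ} {k : ℤ} (hδ : 0 < δ) (hδτ : 16 * δ ≤ wτ) :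
    wτ / (8 * δ) ≤ ((Finset.Icc ⌈((t₀ - wτ / 4) / δ + ((k : ℝ) - 2)) / 2⌉ ⌊((t₀ + wτ / 4) / δ + ((k : ℝ) - 2)) / 2⌋).card : ℝ) ∧
    ∀ p ∈ Finset.Icc ⌈((t₀ - wτ / 4) / δ + ((k : ℝ) - 2)) / 2⌉ ⌊((t₀ + wτ / 4) / δ + ((k : ℝ) - 2)) / 2⌋,
      |δ * ((2 * p - (k - 2) : ℤ) : ℝ) - t₀| ≤ wτ / 4 := by
  set L : ℝ := ((t₀ - wτ / 4) / δ + ((k : ℝ) - 2)) / 2 with hL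
  set U : ℝ := ((t₀ + wτ / 4) / δ + ((k : ℝ) - 2)) / 2 with hU
  have hdiff : U - L = wτ / (4 * δ) := by rw [hU, hL]; field_simp; ring
  have hpos : 2 ≤ wτ / (8 * δ) := by rw [le_div_iff₀ (by positivity)]; linarith
  have hUL : wτ / (4 * δ) = 2 * (wτ / (8 * δ)) := by field_simp; ring
  constructor
  · have h1 : (⌈L⌉ : ℝ) < L + 1 := Int.ceil_lt_add_one _
    have h2 : U < (⌊U⌋ : ℝ) + 1 := Int.lt_floor_add_one _
    have hle : ⌈L⌉ ≤ ⌊U⌋ + 1 := by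
      have : (⌈L⌉ : ℝ) ≤ (⌊U⌋ : ℝ) + 1 := by linarith
      exact_mod_cast this
    have hc : (((Finset.Icc ⌈L⌉ ⌊U⌋).card : ℤ) : ℝ) = (⌊U⌋ : ℝ) + 1 - ⌈L⌉ := by
      rw [Int.card_Icc_of_le _ _ hle]; push_cast; ring
    have : ((Finset.Icc ⌈L⌉ ⌊U⌋).card : ℝ) = (⌊U⌋ : ℝ) + 1 - ⌈L⌉ := by rw [← hc]; norm_cast
    rw [this]; linarith
  · intro p hp
    rw [Finset.mem_Icc] at hp
    obtain ⟨hp1, hp2⟩ := hp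
    have h1 : L ≤ p := (Int.le_ceil L).trans (by exact_mod_cast hp1)
    have h2 : (p : ℝ) ≤ U := le_trans (by exact_mod_cast hp2) (Int.floor_le U)
    rw [hL] at h1
    rw [hU] at h2
    have h1' : (t₀ - wτ / 4) / δ ≤ 2 * p - ((k : ℝ) - 2) := by linarith
    have h2' : 2 * (p : ℝ) - ((k : ℝ) - 2) ≤ (t₀ + wτ / 4) / δ := by linarith
    rw [div_le_iff₀ hδ] at h1'
    rw [le_div_iff₀ hδ] at h2'
    push_cast
    rw [abs_le]; constructor <;> linarith

/-! ## The band and the touch sites -/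

/-- **The band of the arm lies in the deep core.** For a site `x` of level `k - 2` with `|δ column - t₀| ≤ wτ/4`,
the band `{32 |Δcolumn| ≤ n, k - 2 - 3n ≤ level ≤ k - 2}` (`n δ ≤ w₀/16`, `w₀ ≤ wτ`, `16 δ ≤ w₀`) lies in
`{|δ column - t₀| ≤ 5wτ/8 - 2δ, c - 3w₀/4 + 2δ ≤ δ level, level ≤ k - 2}`. [folklore] -/
theorem band_subset {δ c t₀ wτ w₀ : ℝ} {a b k : ℤ} {n : ℕ} (hδ : 0 < δ) (hδτ : 16 * δ ≤ wτ) (hδν : 16 * δ ≤ w₀)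
    (hw : w₀ ≤ wτ) (hk' : c ≤ δ * (k + 1)) (hn16 : (n : ℝ) * δ ≤ w₀ / 16) {x : Site 2}
    (hlx : a * x 0 + b * x 1 = k - 2) (hτ : |δ * ((a * x 0 - b * x 1 : ℤ) : ℝ) - t₀| ≤ wτ / 4) :
    {v : Site 2 | 32 * |(a * v 0 - b * v 1) - (a * x 0 - b * x 1)| ≤ n ∧
        a * x 0 + b * x 1 - 3 * n ≤ a * v 0 + b * v 1 ∧ a * v 0 + b * v 1 ≤ a * x 0 + b * x 1} ⊆
      {v : Site 2 | |δ * ((a * v 0 - b * v 1 : ℤ) : ℝ) - t₀| ≤ 5 * wτ / 8 - 2 * δ ∧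
        c - 3 * w₀ / 4 + 2 * δ ≤ δ * ((a * v 0 + b * v 1 : ℤ) : ℝ) ∧ a * v 0 + b * v 1 ≤ k - 2} := by
  intro v hv
  obtain ⟨h1, h2, h3⟩ := hv
  rw [hlx] at h2 h3
  have hd : |((a * v 0 - b * v 1 : ℤ) : ℝ) - ((a * x 0 - b * x 1 : ℤ) : ℝ)| ≤ n / 32 := by
    rw [le_div_iff₀ (by norm_num)]
    have : ((32 * |(a * v 0 - b * v 1) - (a * x 0 - b * x 1)| : ℤ) : ℝ) ≤ n := by exact_mod_cast h1
    push_cast at this ⊢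
    linarith
  have h2' : ((k : ℤ) : ℝ) - 2 - 3 * n ≤ ((a * v 0 + b * v 1 : ℤ) : ℝ) := by exact_mod_cast h2
  refine ⟨?_, ?_, h3⟩
  · obtain ⟨hd1, hd2⟩ := abs_le.1 hd
    obtain ⟨hτ1, hτ2⟩ := abs_le.1 hτ
    have e : δ * ((a * v 0 - b * v 1 : ℤ) : ℝ) - t₀ = (δ * ((a * x 0 - b * x 1 : ℤ) : ℝ) - t₀) +
        δ * (((a * v 0 - b * v 1 : ℤ) : ℝ) - ((a * x 0 - b * x 1 : ℤ) : ℝ)) := by ring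
    have hδd : |δ * (((a * v 0 - b * v 1 : ℤ) : ℝ) - ((a * x 0 - b * x 1 : ℤ) : ℝ))| ≤ w₀ / 512 := by
      rw [abs_mul, abs_of_pos hδ]
      calc δ * |((a * v 0 - b * v 1 : ℤ) : ℝ) - ((a * x 0 - b * x 1 : ℤ) : ℝ)| ≤ δ * (n / 32) :=
            mul_le_mul_of_nonneg_left hd hδ.le
        _ = (n * δ) / 32 := by ring
        _ ≤ w₀ / 512 := by linarith
    obtain ⟨e1, e2⟩ := abs_le.1 hδd
    rw [e, abs_le]
    constructor <;> linarith
  · have : δ * (((k : ℤ) : ℝ) - 2 - 3 * n) ≤ δ * ((a * v 0 + b * v 1 : ℤ) : ℝ) := mul_le_mul_of_nonneg_left h2' hδ.le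
    nlinarith

/-- **The far end of the arm is far**: a site `3n` levels below `x` is at distance `≥ 3nδ/2 ≥ w₀/32` from it
(`32 δ ≤ w₀`, `w₀/16 - δ < n δ`). [folklore] -/
theorem far_of_level {δ w₀ : ℝ} {a b : ℤ} {n : ℕ} (ha : a = 1 ∨ a = -1) (hb : b = 1 ∨ b = -1) (hδ : 0 < δ)
    (hδν : 32 * δ ≤ w₀) (hnlow : w₀ / 16 - δ < n * δ) {x z : Site 2}
    (hz : a * z 0 + b * z 1 = a * x 0 + b * x 1 - 3 * n) : w₀ / 32 ≤ dist (meshPoint δ z) (meshPoint δ x) := by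
  have hlz : ((a : ℝ) * (meshPoint δ z).re + b * (meshPoint δ z).im) -
      ((a : ℝ) * (meshPoint δ x).re + b * (meshPoint δ x).im) = -(3 * n * δ) := by
    rw [level_meshPoint, level_meshPoint, hz]; push_cast; ring
  have := abs_level_sub_le ha hb (meshPoint δ z) (meshPoint δ x)
  rw [hlz, abs_neg, abs_of_nonneg (by positivity)] at this
  nlinarith

/-- **Level-`(k-2)` sites over the middle of the piece are touch sites**: off both arcs, with the level-`(k-1)`
neighbour `x + a e₀` on the free arc `zdArcB` across an `Ω_δ`-edge, and mesh point in the window. [folklore] -/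
theorem touchSite_mem {E : DiscreteDobrushin} {W : Set ℂ} {δ c t₀ wτ w₀ : ℝ} {a b k : ℤ} (ha : a = 1 ∨ a = -1)
    (hδ : 0 < δ) (hδτ : 16 * δ ≤ wτ) (hδν : 16 * δ ≤ w₀) (hk : δ * k < c)
    (hk' : c ≤ δ * (k + 1)) (hEδ : E.δ = δ)
    (hRW : ∀ z : ℂ, |a * z.re - b * z.im - t₀| < wτ → |a * z.re + b * z.im - c| < w₀ → z ∈ W)
    (hadj : ∀ u w : Site 2, (zdGraph 2).Adj u w →
      |δ * ((a * u 0 - b * u 1 : ℤ) : ℝ) - t₀| ≤ 5 * wτ / 8 → c - 3 * w₀ / 4 ≤ δ * ((a * u 0 + b * u 1 : ℤ) : ℝ) →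
      a * u 0 + b * u 1 ≤ k →
      |δ * ((a * w 0 - b * w 1 : ℤ) : ℝ) - t₀| ≤ 5 * wτ / 8 → c - 3 * w₀ / 4 ≤ δ * ((a * w 0 + b * w 1 : ℤ) : ℝ) →
      a * w 0 + b * w 1 ≤ k → (discreteDomainGraph E.Ω E.δ).Adj u w)
    (hoff : ∀ v : Site 2, |δ * ((a * v 0 - b * v 1 : ℤ) : ℝ) - t₀| ≤ 5 * wτ / 8 - 2 * δ →
      c - 3 * w₀ / 4 + 2 * δ ≤ δ * ((a * v 0 + b * v 1 : ℤ) : ℝ) → a * v 0 + b * v 1 ≤ k - 2 →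
      v ∉ E.zdArcA ∧ v ∉ E.zdArcB)
    (honB : ∀ y : Site 2, |δ * ((a * y 0 - b * y 1 : ℤ) : ℝ) - t₀| ≤ 5 * wτ / 8 - 2 * δ → a * y 0 + b * y 1 = k - 1 →
      y ∈ E.zdArcB)
    {x : Site 2} (hlx : a * x 0 + b * x 1 = k - 2) (hτ : |δ * ((a * x 0 - b * x 1 : ℤ) : ℝ) - t₀| ≤ wτ / 4) :
    x ∉ E.zdArcA ∧ x ∉ E.zdArcB ∧ (∃ y ∈ E.zdArcB, s(x, y) ∈ (discreteDomainGraph E.Ω E.δ).edgeSet) ∧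
      meshPoint E.δ x ∈ W := by
  have ha2 := sign_mul_self ha
  have hlevR : δ * ((a * x 0 + b * x 1 : ℤ) : ℝ) = δ * k - 2 * δ := by rw [hlx]; push_cast; ring
  have hτ' : |δ * ((a * x 0 - b * x 1 : ℤ) : ℝ) - t₀| ≤ 5 * wτ / 8 - 2 * δ := hτ.trans (by linarith)
  obtain ⟨hτ1, hτ2⟩ := abs_le.1 hτ
  -- the free-arc neighbour `y`
  set y : Site 2 := x + Pi.single 0 a with hy
  have hy0 : y 0 = x 0 + a := by simp [hy]
  have hy1 : y 1 = x 1 := by simp [hy]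
  have hly : a * y 0 + b * y 1 = k - 1 := by rw [hy0, hy1, mul_add, ha2]; linarith
  have htyR : δ * ((a * y 0 - b * y 1 : ℤ) : ℝ) = δ * ((a * x 0 - b * x 1 : ℤ) : ℝ) + δ := by
    rw [hy0, hy1, mul_add, ha2]; push_cast; ring
  have hτy : |δ * ((a * y 0 - b * y 1 : ℤ) : ℝ) - t₀| ≤ 5 * wτ / 8 - 2 * δ := by
    rw [htyR, abs_le]; constructor <;> linarith
  have hlyR : δ * ((a * y 0 + b * y 1 : ℤ) : ℝ) = δ * k - δ := by rw [hly]; push_cast; ring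
  have hyB : y ∈ E.zdArcB := honB y hτy hly
  have hxy : (zdGraph 2).Adj x y := by rw [hy]; exact zdGraph_adj_add_single _ 0 ha
  have hedge : s(x, y) ∈ (discreteDomainGraph E.Ω E.δ).edgeSet := by
    rw [SimpleGraph.mem_edgeSet]
    refine hadj x y hxy (hτ'.trans (by linarith)) ?_ (by omega) (hτy.trans (by linarith)) ?_ (by omega)
    · rw [hlevR]; linarith
    · rw [hlyR]; linarith
  have hoffx := hoff x hτ' (by rw [hlevR]; linarith) hlx.le
  have hW : meshPoint E.δ x ∈ W := by
    rw [hEδ]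
    refine hRW _ ?_ ?_
    · rw [column_meshPoint, abs_lt]; constructor <;> linarith
    · rw [level_meshPoint, hlevR, abs_lt]; constructor <;> linarith
  exact ⟨hoffx.1, hoffx.2, ⟨y, hyB, hedge⟩, hW⟩

/-! ## The local touch lower bound -/

/-- **The LOCAL touch lower bound** (registered sub-goal `touchLowerBound_local` of `stub_touchLowerBound`, reshape
r2, line `exact-potential-schwarz-christoffel`). See the module docstring.
[cite: Nolin2008, §4.3, proof of Prop. 12 (i) (arXiv 0711.4948: Prop. 11), with §4.6] -/
theorem touchLowerBound_local : ∀ (P : DobrushinDomain) (Λ : ℝ → DiscreteDobrushin), IsFamily P Λ → ∀ (W : Set ℂ), Disjoint (closure W) (P.arc 0) → ∀ (a b : ℤ) (c t₀ wτ wν : ℝ), (a = 1 ∨ a = -1) → (b = 1 ∨ b = -1) → 0 < wτ → 0 < wν → (∀ z : ℂ, |a * z.re - b * z.im - t₀| < wτ → |a * z.re + b * z.im - c| < wν → z ∈ W) → (∀ z : ℂ, |a * z.re - b * z.im - t₀| < wτ → c - wν < a * z.re + b * z.im → a * z.re + b * z.im < c → z ∈ P.carrier) → (∀ z : ℂ,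 |a * z.re - b * z.im - t₀| < wτ → c < a * z.re + b * z.im → a * z.re + b * z.im < c + wν → z ∉ P.carrier) → ∃ η > (0:ℝ), ∃ m > (0:ℝ), ∀ᶠ δ in 𝓝[>] (0:ℝ), m ≤ δ ^ ((2:ℝ) / 3) * ∑ᶠ x : Site 2, Set.indicator {x : Site 2 | x ∉ (Λ δ).zdArcA ∧ x ∉ (Λ δ).zdArcB ∧ (∃ y ∈ (Λ δ).zdArcB, s(x, y) ∈ (discreteDomainGraph (Λ δ).Ω (Λ δ).δ).edgeSet) ∧ meshPoint (Λ δ).δ x ∈ W} (fun x => (bondPercolation (zdGraph 2) half).real {ω | ∃ z : Site 2, η ≤ dist (meshPoint δ z) (meshPoint δ x) ∧ (openGraph ((Λ δ).bcBondConfig ω)).Reachable x z}) x := by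
  intro P Λ hΛ W hW a b c t₀ wτ wν ha hb hwτ hwν hRW hin hout
  classical
  have ha2 := sign_mul_self ha
  have hb2 := sign_mul_self hb
  -- WLOG `wν ≤ wτ`
  set w₀ : ℝ := min wν wτ with hw₀_def
  have hw₀ : 0 < w₀ := lt_min hwν hwτ
  have hw₀ν : w₀ ≤ wν := min_le_left _ _
  have hw₀τ : w₀ ≤ wτ := min_le_right _ _
  have hRW' : ∀ z : ℂ, |a * z.re - b * z.im - t₀| < wτ → |a * z.re + b * z.im - c| < w₀ → z ∈ W :=
    fun z h1 h2 => hRW z h1 (lt_of_lt_of_le h2 hw₀ν)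
  have hin' : ∀ z : ℂ, |a * z.re - b * z.im - t₀| < wτ → c - w₀ < a * z.re + b * z.im → a * z.re + b * z.im < c →
      z ∈ P.carrier := fun z h1 h2 h3 => hin z h1 (by linarith) h3
  have hout' : ∀ z : ℂ, |a * z.re - b * z.im - t₀| < wτ → c < a * z.re + b * z.im → a * z.re + b * z.im < c + w₀ →
      z ∉ P.carrier := fun z h1 h2 h3 => hout z h1 h2 (by linarith)
  obtain ⟨c₀, hc₀, L₀, harm⟩ := wallArm_bc_lower
  have hpack := wall_package P Λ hΛ W hW ha hb hwτ hw₀ hRW' hin' hout'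
  refine ⟨w₀ / 32, by positivity, c₀ * (16 / w₀) ^ ((1:ℝ) / 3) * wτ / 8, by positivity, ?_⟩
  have hδ₁ : (0:ℝ) < w₀ / (32 * ((L₀ : ℝ) + 2)) := by positivity
  filter_upwards [hpack, Ioo_mem_nhdsGT hδ₁] with δ hp hδδ
  obtain ⟨k, hk, hk', hδ, hδτ, hδν, hEΩ, hEδ, hadj, hoff, honB⟩ := hp
  obtain ⟨-, hδlt⟩ := hδδ
  have hL₀2 : ((L₀ : ℝ) + 2) * δ ≤ w₀ / 32 := by
    have := hδlt.le
    rw [le_div_iff₀ (by positivity)] at this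
    linarith
  have hL₀0 : (0:ℝ) ≤ L₀ := Nat.cast_nonneg L₀
  have hδ32 : 32 * δ ≤ w₀ := by nlinarith
  -- the band depth `n`
  obtain ⟨n, hn_def⟩ : ∃ n : ℕ, n = ⌊w₀ / (16 * δ)⌋₊ := ⟨_, rfl⟩
  have hx0 : (0:ℝ) ≤ w₀ / (16 * δ) := by positivity
  have hn16 : (n : ℝ) * δ ≤ w₀ / 16 := by
    have h1 : (n : ℝ) ≤ w₀ / (16 * δ) := hn_def ▸ Nat.floor_le hx0
    rw [le_div_iff₀ (by positivity)] at h1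
    linarith
  have hnlow : w₀ / 16 - δ < (n : ℝ) * δ := by
    have h1 : w₀ / (16 * δ) < (n : ℝ) + 1 := hn_def ▸ Nat.lt_floor_add_one _
    rw [div_lt_iff₀ (by positivity)] at h1
    linarith
  have hnL : L₀ ≤ n := by
    rw [hn_def, Nat.le_floor_iff hx0, le_div_iff₀ (by positivity)]
    nlinarith
  have hn0 : 0 < n := by
    rw [hn_def, Nat.floor_pos, one_le_div (by positivity)]
    nlinarith
  -- the per-site probability bound `β`
  set β : ℝ := c₀ * (16 / w₀) ^ ((1:ℝ) / 3) * δ ^ ((1:ℝ) / 3) with hβ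
  have hβn : β ≤ c₀ * (n : ℝ) ^ (-(1:ℝ) / 3) := by
    rw [hβ, mul_assoc]; exact mul_le_mul_of_nonneg_left (rpow_band hδ hw₀ hn0 hn16) hc₀.le
  -- the touch sites `xs p = (a p, b (k - 2 - p))`, `p ∈ F`
  obtain ⟨xs, hxs⟩ : ∃ xs : ℤ → Site 2, xs = fun p => ![a * p, b * (k - 2 - p)] := ⟨_, rfl⟩
  have hX₀ : ∀ p, xs p 0 = a * p := fun p => by simp [hxs]
  have hX₁ : ∀ p, xs p 1 = b * (k - 2 - p) := fun p => by simp [hxs]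
  have hlx : ∀ p, a * xs p 0 + b * xs p 1 = k - 2 := fun p => by
    rw [hX₀, hX₁, ← mul_assoc, ← mul_assoc, ha2, hb2]; ring
  have htx : ∀ p, a * xs p 0 - b * xs p 1 = 2 * p - (k - 2) := fun p => by
    rw [hX₀, hX₁, ← mul_assoc, ← mul_assoc, ha2, hb2]; ring
  have hinj : Function.Injective xs := by
    intro p q hpq
    have := congrFun hpq 0
    rw [hX₀, hX₀] at this
    rcases ha with rfl | rfl <;> linarith
  obtain ⟨hFcard, hFτ⟩ := card_lower (t₀ := t₀) (k := k) hδ hδτ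
  set F : Finset ℤ := Finset.Icc ⌈((t₀ - wτ / 4) / δ + ((k : ℝ) - 2)) / 2⌉ ⌊((t₀ + wτ / 4) / δ + ((k : ℝ) - 2)) / 2⌋
    with hF
  -- the touch set, the summand, the band
  set S : Set (Site 2) := {x : Site 2 | x ∉ (Λ δ).zdArcA ∧ x ∉ (Λ δ).zdArcB ∧
      (∃ y ∈ (Λ δ).zdArcB, s(x, y) ∈ (discreteDomainGraph (Λ δ).Ω (Λ δ).δ).edgeSet) ∧ meshPoint (Λ δ).δ x ∈ W}
    with hS
  set g : Site 2 → ℝ := fun x => (μ).real {ω | ∃ z : Site 2, w₀ / 32 ≤ dist (meshPoint δ z) (meshPoint δ x) ∧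
      (openGraph ((Λ δ).bcBondConfig ω)).Reachable x z} with hg
  have hg0 : ∀ x, 0 ≤ S.indicator g x := fun x => Set.indicator_nonneg (fun _ _ => measureReal_nonneg) x
  set R : Set (Site 2) := {v : Site 2 | |δ * ((a * v 0 - b * v 1 : ℤ) : ℝ) - t₀| ≤ 5 * wτ / 8 - 2 * δ ∧
      c - 3 * w₀ / 4 + 2 * δ ≤ δ * ((a * v 0 + b * v 1 : ℤ) : ℝ) ∧ a * v 0 + b * v 1 ≤ k - 2} with hR
  have hRadj : ∀ v ∈ R, ∀ u ∈ R, (zdGraph 2).Adj v u → (discreteDomainGraph (Λ δ).Ω (Λ δ).δ).Adj v u :=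
    fun v hv u hu hvu => hadj v u hvu (by linarith [hv.1]) (by linarith [hv.2.1]) (by linarith [hv.2.2])
      (by linarith [hu.1]) (by linarith [hu.2.1]) (by linarith [hu.2.2])
  have hRB : ∀ v ∈ R, v ∉ (Λ δ).zdArcB := fun v hv => (hoff v hv.1 hv.2.1 hv.2.2).2
  -- per site
  have hsite : ∀ p ∈ F, xs p ∈ S ∧ β ≤ g (xs p) := by
    intro p hp
    have hτ : |δ * ((a * xs p 0 - b * xs p 1 : ℤ) : ℝ) - t₀| ≤ wτ / 4 := by rw [htx]; exact hFτ p hp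
    refine ⟨touchSite_mem ha hδ hδτ hδν hk hk' hEδ hRW' hadj hoff honB (hlx p) hτ, ?_⟩
    have hP := harm n hnL a b ha hb (Λ δ) R (xs p) (band_subset hδ hδτ hδν hw₀τ hk' hn16 (hlx p) hτ) hRadj hRB
    refine hβn.trans (hP.trans (measureReal_mono ?_))
    rintro ω ⟨z, hz, hreach⟩
    exact ⟨z, far_of_level ha hb hδ hδ32 hnlow hz, hreach⟩
  -- summation
  have hfin : (Function.support (S.indicator g)).Finite := by
    refine (meshVertices_finite P.isBounded hδ).subset fun x hx => ?_
    obtain ⟨-, -, ⟨y, -, hxy⟩, -⟩ := Set.support_indicator_subset hx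
    rw [SimpleGraph.mem_edgeSet, hEΩ, hEδ] at hxy
    exact meshDomain_subset_meshVertices _ _ (discreteDomainGraph_adj_iff.1 hxy).2.1
  have hsum : (F.card : ℝ) * β ≤ ∑ᶠ x : Site 2, S.indicator g x := by
    calc (F.card : ℝ) * β = ∑ p ∈ F, β := by rw [Finset.sum_const, nsmul_eq_mul]
      _ ≤ ∑ p ∈ F, S.indicator g (xs p) := Finset.sum_le_sum fun p hp => by
          obtain ⟨hS', hβ'⟩ := hsite p hp
          rw [Set.indicator_of_mem hS']
          exact hβ'
      _ = ∑ x ∈ F.image xs, S.indicator g x := (Finset.sum_image fun p _ q _ h => hinj h).symm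
      _ ≤ ∑ᶠ x : Site 2, S.indicator g x := sum_le_finsum_of_nonneg hg0 hfin _
  have hβ0 : 0 ≤ β := by positivity
  calc c₀ * (16 / w₀) ^ ((1:ℝ) / 3) * wτ / 8
      = δ ^ ((2:ℝ) / 3) * (wτ / (8 * δ) * β) := by rw [hβ, rpow_bookkeeping hδ]
    _ ≤ δ ^ ((2:ℝ) / 3) * ((F.card : ℝ) * β) := by gcongr
    _ ≤ δ ^ ((2:ℝ) / 3) * ∑ᶠ x : Site 2, S.indicator g x := mul_le_mul_of_nonneg_left hsum (by positivity)

end Summit.CriticalPhenomena.CardyFormulaZ2.Theorems.ParafermionFamiliesToSLESix.TouchLowerBound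

end
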